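import Mathlib.MeasureTheory.Measure.Haar.NormedSpace
import Mathlib.MeasureTheory.Integral.DominatedConvergence
import Mathlib.Analysis.SpecialFunctions.Pow.Asymptotics
import Literature.Probability.LatticeModels.SRWHeatKernelDifferences
import HarnessLib

/-!
# Crux `UVSeamRec` (stmt-QuantumFields-20043), line «coldwall_pure»: THE LAPLACE METHOD IN RATIO FORM (multivariate,
# quadratic minimum, measurable data) — the analytic engine of the semiclassical limit of the cold-wall cube kernels

Helper file (`--supports stmt-QuantumFields-20043`) of the LEAD seat `ym-spine-20043-p1` (gen 14), programme «SEMICLASSICAL CUBE KERNELS»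
(LEAD g12 successor step (3)): the fixed-cube `β → ∞` limit of `β · kerE^𝟙_{β,(c,b)}(2 − Re tr U_p)` is the lattice-Maxwell (Gaussian) Dirichlet
value — the zeroth order of the background-field expansion that `stub_coldWallSplit` (CW) and `stub_dirichletRate` (DR) of `Lines/coldwall_pure.lean`
posit uniformly on the window.  This file is the ENGINE, on an arbitrary finite-dimensional real normed space `E` with an additive Haar measure `μ`:
`G ≥ 0` (the action in a chart at its unique minimum `0`), `w ≥ 0` (chart density: integrable, bounded, continuous at `0`), `h` (observable)
measurable; `U ∋ 0` a measurable neighbourhood with `G ≥ c‖v‖²` on `U`, `G ≥ s₀ > 0` off `U`; `|h| ≤ K·G` on `U`, `|h| ≤ H₀`; rescaled pointwise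
limits `β·G(z/√β) → Q(z)`, `β·h(z/√β) → q(z)`.  Then (`n = dim E`): `tendsto_sqrt_pow_mul_integral_exp_neg_mul` — `(√β)^n ∫ e^{−βG} w → w(0)∫e^{−Q}`;
`tendsto_sqrt_pow_mul_mul_integral_mul_exp_neg_mul` — `(√β)^n β ∫ h e^{−βG} w → w(0)∫ q e^{−Q}`; **`tendsto_mul_integral_div_integral`** —
`β·(∫ h e^{−βG} w)/(∫ e^{−βG} w) → (∫ q e^{−Q})/(∫ e^{−Q})`; `tendsto_mul_add_div_add_of_negligible` — the limit survives exponentially small additive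
perturbations (the far hemispheres of the `SU(2)` links in the sequel).  Proof: split at `U` (outside: `O(e^{−s₀β})` against the polynomial
prefactor); inside substitute `v = z/√β` (`Measure.integral_comp_inv_smul_of_nonneg`) and use dominated convergence along `atTop` with dominant
`e^{−(c/2)‖z‖²}` (its `μ`-integrability is a hypothesis the consumer supplies for its concrete `E`).  [folklore: de Bruijn, Asymptotic Methods in
Analysis, Ch. 4; Wong, Asymptotic Approximations of Integrals, Ch. IX §5]  HONEST FRAMING: classical real analysis; YM mass gap NOT proved; not Clay.
-/

open MeasureTheory Filter Topology Set Module

noncomputable section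

namespace Summit.QuantumFields.YangMills.Cruxes.UVSeamRec.ClassicalResponse.ColdWall.Laplace

variable {E : Type*} [NormedAddCommGroup E] [NormedSpace ℝ E] [MeasurableSpace E] [BorelSpace E]
  [FiniteDimensional ℝ E] (μ : Measure E) [μ.IsAddHaarMeasure]

/-! ### §1 Elementary pieces: the scaling identity and the exponential remainder (`t e^{−t} ≤ 2e^{−t/2}` is the tree's, in `SRWHeatKernelDifferences`) -/

/-- The substitution `v = z/√β` under an additive Haar measure: `(√β)^{dim E} ∫ f(v) dμ(v) = ∫ f(z/√β) dμ(z)`. [folklore] -/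
theorem sqrt_pow_mul_integral_eq (f : E → ℝ) (β : ℝ) :
    Real.sqrt β ^ finrank ℝ E * ∫ v, f v ∂μ = ∫ z, f ((Real.sqrt β)⁻¹ • z) ∂μ := by
  rw [Measure.integral_comp_inv_smul_of_nonneg μ f (Real.sqrt_nonneg β), smul_eq_mul]

omit [MeasurableSpace E] [BorelSpace E] [FiniteDimensional ℝ E] in
/-- `β · ‖z/√β‖² = ‖z‖²` for `β > 0`. [folklore] -/
theorem mul_norm_inv_sqrt_smul_sq {β : ℝ} (hβ : 0 < β) (z : E) :
    β * ‖(Real.sqrt β)⁻¹ • z‖ ^ 2 = ‖z‖ ^ 2 := by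
  rw [norm_smul, norm_inv, Real.norm_of_nonneg (Real.sqrt_pos.2 hβ).le, mul_pow, inv_pow, Real.sq_sqrt hβ.le]
  field_simp

omit [MeasurableSpace E] [BorelSpace E] [FiniteDimensional ℝ E] in
/-- `z/√β → 0` as `β → ∞`. [folklore] -/
theorem tendsto_inv_sqrt_smul (z : E) : Tendsto (fun β : ℝ => (Real.sqrt β)⁻¹ • z) atTop (𝓝 0) := by
  have h1 : Tendsto (fun β : ℝ => (Real.sqrt β)⁻¹) atTop (𝓝 0) :=
    tendsto_inv_atTop_zero.comp Real.tendsto_sqrt_atTop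
  simpa using h1.smul_const z

/-- The polynomial prefactor against an exponential: `(√β)^n · β^k · e^{−s₀β} → 0` for `s₀ > 0`. [folklore] -/
theorem tendsto_sqrt_pow_mul_pow_mul_exp_neg (n k : ℕ) {s₀ : ℝ} (hs : 0 < s₀) :
    Tendsto (fun β : ℝ => Real.sqrt β ^ n * β ^ k * Real.exp (-(s₀ * β))) atTop (𝓝 0) := by
  have h := tendsto_rpow_mul_exp_neg_mul_atTop_nhds_zero ((n : ℝ) / 2 + k) s₀ hs
  refine h.congr' ?_
  filter_upwards [eventually_gt_atTop (0 : ℝ)] with β hβ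
  have h1 : β ^ ((n : ℝ) / 2 + k) = Real.sqrt β ^ n * β ^ k := by
    rw [Real.rpow_add hβ, Real.rpow_natCast, Real.sqrt_eq_rpow, ← Real.rpow_natCast (β ^ (1 / (2 : ℝ))) n,
      ← Real.rpow_mul hβ.le]
    congr 1
    ring_nf
  rw [h1, neg_mul]

/-- Squeeze form: if `|f β| ≤ C e^{−s₀β}` eventually then `(√β)^n · β^k · f β → 0`. [folklore] -/
theorem tendsto_sqrt_pow_mul_pow_mul_of_abs_le (n k : ℕ) {s₀ C : ℝ} (hs : 0 < s₀) {f : ℝ → ℝ}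
    (hf : ∀ᶠ β in atTop, |f β| ≤ C * Real.exp (-(s₀ * β))) :
    Tendsto (fun β : ℝ => Real.sqrt β ^ n * β ^ k * f β) atTop (𝓝 0) := by
  have h0 := (tendsto_sqrt_pow_mul_pow_mul_exp_neg n k hs).const_mul C
  rw [mul_zero] at h0; refine squeeze_zero_norm' ?_ h0
  filter_upwards [hf, eventually_ge_atTop (0 : ℝ)] with β hβ hβ0
  rw [Real.norm_eq_abs, abs_mul, abs_mul, abs_of_nonneg (pow_nonneg (Real.sqrt_nonneg _) _),
    abs_of_nonneg (pow_nonneg hβ0 _)]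
  calc Real.sqrt β ^ n * β ^ k * |f β| ≤ Real.sqrt β ^ n * β ^ k * (C * Real.exp (-(s₀ * β))) :=
        mul_le_mul_of_nonneg_left hβ (mul_nonneg (pow_nonneg (Real.sqrt_nonneg _) _) (pow_nonneg hβ0 _))
    _ = C * (Real.sqrt β ^ n * β ^ k * Real.exp (-(s₀ * β))) := by ring

/-! ### §2 The two Laplace asymptotics -/

section Main

variable {G h w Q q : E → ℝ} {U : Set E} {c s₀ W₀ K H₀ : ℝ}

omit [NormedSpace ℝ E] [BorelSpace E] [FiniteDimensional ℝ E] [μ.IsAddHaarMeasure] in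
/-- The exterior estimate: `|∫_{Uᶜ} φ · e^{−βG} · w| ≤ M e^{−s₀β} ∫ w` when `|φ| ≤ M`, `G ≥ s₀` off `U`, `w ≥ 0` integrable, `β ≥ 0`.
[folklore] -/
theorem abs_integral_indicator_compl_le
    (hGout : ∀ v ∉ U, s₀ ≤ G v) (hw0 : ∀ v, 0 ≤ w v) (hwi : Integrable w μ)
    {φ : E → ℝ} {M : ℝ} (hφ : ∀ v, |φ v| ≤ M) {β : ℝ} (hβ : 0 ≤ β) :
    |∫ v, Uᶜ.indicator (fun v => φ v * Real.exp (-(β * G v)) * w v) v ∂μ| ≤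
      M * Real.exp (-(s₀ * β)) * ∫ v, w v ∂μ := by
  have hM : 0 ≤ M := (abs_nonneg _).trans (hφ 0)
  rw [← integral_const_mul]
  refine (abs_integral_le_integral_abs).trans (integral_mono_of_nonneg (ae_of_all _ fun v => abs_nonneg _)
    (hwi.const_mul _) (ae_of_all _ fun v => ?_))
  dsimp only
  by_cases hv : v ∈ Uᶜ
  · rw [indicator_of_mem hv, abs_mul, abs_mul, abs_of_nonneg (Real.exp_pos _).le, abs_of_nonneg (hw0 v)]
    have h1 : Real.exp (-(β * G v)) ≤ Real.exp (-(s₀ * β)) := by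
      rw [Real.exp_le_exp]; have := hGout v hv; nlinarith
    calc |φ v| * Real.exp (-(β * G v)) * w v ≤ M * Real.exp (-(s₀ * β)) * w v := by
          gcongr
          · exact hw0 v
          · exact hφ v
      _ = M * Real.exp (-(s₀ * β)) * w v := rfl
  · rw [indicator_of_notMem hv, abs_zero]
    exact mul_nonneg (mul_nonneg hM (Real.exp_pos _).le) (hw0 v)

/-- **Laplace asymptotics of the partition function.**  `(√β)^{dim E} ∫ e^{−βG} w dμ → w(0) ∫ e^{−Q} dμ`. [folklore] -/
theorem tendsto_sqrt_pow_mul_integral_exp_neg_mul (hGm : Measurable G) (hwm : Measurable w)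
    (hUm : MeasurableSet U) (hU0 : U ∈ 𝓝 (0 : E)) (hc : 0 < c) (hs₀ : 0 < s₀)
    (hG0 : ∀ v, 0 ≤ G v) (hGU : ∀ v ∈ U, c * ‖v‖ ^ 2 ≤ G v) (hGout : ∀ v ∉ U, s₀ ≤ G v)
    (hw0 : ∀ v, 0 ≤ w v) (hwW : ∀ v, w v ≤ W₀) (hwi : Integrable w μ) (hwc : ContinuousAt w 0)
    (hgauss : Integrable (fun z : E => Real.exp (-(c / 2 * ‖z‖ ^ 2))) μ)
    (hQ : ∀ z, Tendsto (fun β : ℝ => β * G ((Real.sqrt β)⁻¹ • z)) atTop (𝓝 (Q z))) :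
    Tendsto (fun β : ℝ => Real.sqrt β ^ finrank ℝ E * ∫ v, Real.exp (-(β * G v)) * w v ∂μ) atTop
      (𝓝 (w 0 * ∫ z, Real.exp (-Q z) ∂μ)) := by
  have hW₀ : 0 ≤ W₀ := (hw0 0).trans (hwW 0)
  -- the integrand and its split at `U`
  set f : ℝ → E → ℝ := fun β v => Real.exp (-(β * G v)) * w v with hf
  have hfm : ∀ β, Measurable (f β) := fun β =>
    (Real.measurable_exp.comp (hGm.const_mul β).neg).mul hwm
  have hfi : ∀ β, 0 ≤ β → Integrable (f β) μ := by
    intro β hβ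
    refine Integrable.mono' hwi (hfm β).aestronglyMeasurable (ae_of_all _ fun v => ?_)
    rw [hf]; dsimp only
    rw [Real.norm_eq_abs, abs_mul, abs_of_nonneg (Real.exp_pos _).le, abs_of_nonneg (hw0 v)]
    have : Real.exp (-(β * G v)) ≤ 1 := by
      rw [Real.exp_le_one_iff]; have := hG0 v; nlinarith
    simpa using mul_le_mul_of_nonneg_right this (hw0 v)
  have hsplit : ∀ β, 0 ≤ β → ∫ v, f β v ∂μ = (∫ v, U.indicator (f β) v ∂μ) + ∫ v, Uᶜ.indicator (f β) v ∂μ := by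
    intro β hβ
    rw [← integral_add ((hfi β hβ).indicator hUm) ((hfi β hβ).indicator hUm.compl)]
    congr 1; funext v
    by_cases hv : v ∈ U
    · rw [indicator_of_mem hv, indicator_of_notMem (show v ∉ Uᶜ from fun hc => hc hv), add_zero]
    · rw [indicator_of_notMem hv, indicator_of_mem (mem_compl hv), zero_add]
  -- (1) the exterior part is exponentially small
  have hout : Tendsto (fun β : ℝ => Real.sqrt β ^ finrank ℝ E * ∫ v, Uᶜ.indicator (f β) v ∂μ) atTop (𝓝 0) := by
    have h := tendsto_sqrt_pow_mul_pow_mul_of_abs_le (finrank ℝ E) 0 (C := 1 * ∫ v, w v ∂μ) hs₀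
      (f := fun β => ∫ v, Uᶜ.indicator (f β) v ∂μ) ?_
    · simpa using h
    filter_upwards [eventually_ge_atTop (0 : ℝ)] with β hβ
    have h1 := abs_integral_indicator_compl_le μ hGout hw0 hwi (φ := fun _ => (1 : ℝ)) (M := 1) (fun v => by simp) hβ
      (G := G)
    have h2 : (fun v => Uᶜ.indicator (fun v => (1 : ℝ) * Real.exp (-(β * G v)) * w v) v) = fun v => Uᶜ.indicator (f β) v := by
      funext v; simp only [one_mul, hf]
    rw [h2] at h1
    calc |∫ v, Uᶜ.indicator (f β) v ∂μ| ≤ 1 * Real.exp (-(s₀ * β)) * ∫ v, w v ∂μ := h1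
      _ = (1 * ∫ v, w v ∂μ) * Real.exp (-(s₀ * β)) := by ring
  -- (2) the interior part after the substitution `v = z/√β`
  have hin : Tendsto (fun β : ℝ => Real.sqrt β ^ finrank ℝ E * ∫ v, U.indicator (f β) v ∂μ) atTop
      (𝓝 (w 0 * ∫ z, Real.exp (-Q z) ∂μ)) := by
    have heq : ∀ β, Real.sqrt β ^ finrank ℝ E * ∫ v, U.indicator (f β) v ∂μ =
        ∫ z, U.indicator (f β) ((Real.sqrt β)⁻¹ • z) ∂μ := fun β => sqrt_pow_mul_integral_eq μ _ β
    simp_rw [heq]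
    rw [← integral_const_mul]
    refine tendsto_integral_filter_of_dominated_convergence (fun z => W₀ * Real.exp (-(c / 2 * ‖z‖ ^ 2))) ?_ ?_
      (hgauss.const_mul W₀) ?_
    · refine Eventually.of_forall fun β => ?_
      exact (((hfm β).indicator hUm).comp (measurable_const_smul _)).aestronglyMeasurable
    · filter_upwards [eventually_gt_atTop (0 : ℝ)] with β hβ
      refine ae_of_all _ fun z => ?_
      rw [Real.norm_eq_abs]
      by_cases hz : (Real.sqrt β)⁻¹ • z ∈ U
      · rw [indicator_of_mem hz, hf]; dsimp only
        rw [abs_mul, abs_of_nonneg (Real.exp_pos _).le, abs_of_nonneg (hw0 _)]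
        have hG1 : c * ‖z‖ ^ 2 ≤ β * G ((Real.sqrt β)⁻¹ • z) := by
          have h1 := hGU _ hz
          have h2 := mul_norm_inv_sqrt_smul_sq hβ z
          calc c * ‖z‖ ^ 2 = β * (c * ‖(Real.sqrt β)⁻¹ • z‖ ^ 2) := by rw [← h2]; ring
            _ ≤ β * G ((Real.sqrt β)⁻¹ • z) := mul_le_mul_of_nonneg_left h1 hβ.le
        have hexp : Real.exp (-(β * G ((Real.sqrt β)⁻¹ • z))) ≤ Real.exp (-(c / 2 * ‖z‖ ^ 2)) := by
          rw [Real.exp_le_exp]; nlinarith [sq_nonneg ‖z‖, hc]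
        calc Real.exp (-(β * G ((Real.sqrt β)⁻¹ • z))) * w ((Real.sqrt β)⁻¹ • z)
            ≤ Real.exp (-(c / 2 * ‖z‖ ^ 2)) * W₀ := mul_le_mul hexp (hwW _) (hw0 _) (Real.exp_pos _).le
          _ = W₀ * Real.exp (-(c / 2 * ‖z‖ ^ 2)) := mul_comm _ _
      · rw [indicator_of_notMem hz, abs_zero]; exact mul_nonneg hW₀ (Real.exp_pos _).le
    · refine ae_of_all _ fun z => ?_
      have hzU : ∀ᶠ β : ℝ in atTop, (Real.sqrt β)⁻¹ • z ∈ U := (tendsto_inv_sqrt_smul z) hU0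
      have hlim : Tendsto (fun β : ℝ => f β ((Real.sqrt β)⁻¹ • z)) atTop (𝓝 (Real.exp (-Q z) * w 0)) := by
        rw [hf]
        exact ((Real.continuous_exp.tendsto _).comp (hQ z).neg).mul (hwc.tendsto.comp (tendsto_inv_sqrt_smul z))
      have hlim' : Tendsto (fun β : ℝ => U.indicator (f β) ((Real.sqrt β)⁻¹ • z)) atTop (𝓝 (Real.exp (-Q z) * w 0)) := by
        refine hlim.congr' ?_
        filter_upwards [hzU] with β hβ
        rw [indicator_of_mem hβ]
      simpa [mul_comm] using hlim'
  -- assemble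
  have hsum := hin.add hout
  rw [add_zero] at hsum; refine hsum.congr' ?_
  filter_upwards [eventually_ge_atTop (0 : ℝ)] with β hβ; rw [← mul_add, ← hsplit β hβ]

/-- **Laplace asymptotics of an observable vanishing to second order at the minimum.**
`(√β)^{dim E} · β ∫ h e^{−βG} w dμ → w(0) ∫ q e^{−Q} dμ`. [folklore] -/
theorem tendsto_sqrt_pow_mul_mul_integral_mul_exp_neg_mul (hGm : Measurable G) (hhm : Measurable h) (hwm : Measurable w)
    (hUm : MeasurableSet U) (hU0 : U ∈ 𝓝 (0 : E)) (hs₀ : 0 < s₀) (hK : 0 ≤ K)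
    (hG0 : ∀ v, 0 ≤ G v) (hGU : ∀ v ∈ U, c * ‖v‖ ^ 2 ≤ G v) (hGout : ∀ v ∉ U, s₀ ≤ G v)
    (hhU : ∀ v ∈ U, |h v| ≤ K * G v) (hhb : ∀ v, |h v| ≤ H₀)
    (hw0 : ∀ v, 0 ≤ w v) (hwW : ∀ v, w v ≤ W₀) (hwi : Integrable w μ) (hwc : ContinuousAt w 0)
    (hgauss : Integrable (fun z : E => Real.exp (-(c / 2 * ‖z‖ ^ 2))) μ)
    (hQ : ∀ z, Tendsto (fun β : ℝ => β * G ((Real.sqrt β)⁻¹ • z)) atTop (𝓝 (Q z)))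
    (hq : ∀ z, Tendsto (fun β : ℝ => β * h ((Real.sqrt β)⁻¹ • z)) atTop (𝓝 (q z))) :
    Tendsto (fun β : ℝ => Real.sqrt β ^ finrank ℝ E * (β * ∫ v, h v * Real.exp (-(β * G v)) * w v ∂μ)) atTop
      (𝓝 (w 0 * ∫ z, q z * Real.exp (-Q z) ∂μ)) := by
  have hW₀ : 0 ≤ W₀ := (hw0 0).trans (hwW 0)
  have hH₀ : 0 ≤ H₀ := (abs_nonneg _).trans (hhb 0)
  set f : ℝ → E → ℝ := fun β v => β * h v * Real.exp (-(β * G v)) * w v with hf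
  have hfm : ∀ β, Measurable (f β) := fun β =>
    (((hhm.const_mul β).mul (Real.measurable_exp.comp (hGm.const_mul β).neg)).mul hwm)
  have hfi : ∀ β, 0 ≤ β → Integrable (f β) μ := by
    intro β hβ
    refine Integrable.mono' (hwi.const_mul (β * H₀)) (hfm β).aestronglyMeasurable (ae_of_all _ fun v => ?_)
    rw [hf]; dsimp only
    rw [Real.norm_eq_abs, abs_mul, abs_mul, abs_mul, abs_of_nonneg (Real.exp_pos _).le, abs_of_nonneg (hw0 v),
      abs_of_nonneg hβ]
    have h1 : Real.exp (-(β * G v)) ≤ 1 := by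
      rw [Real.exp_le_one_iff]; have := hG0 v; nlinarith
    calc β * |h v| * Real.exp (-(β * G v)) * w v ≤ β * H₀ * 1 * w v := by
          gcongr
          · exact hw0 v
          · exact hhb v
      _ = β * H₀ * w v := by ring
  have hsplit : ∀ β, 0 ≤ β → ∫ v, f β v ∂μ = (∫ v, U.indicator (f β) v ∂μ) + ∫ v, Uᶜ.indicator (f β) v ∂μ := by
    intro β hβ
    rw [← integral_add ((hfi β hβ).indicator hUm) ((hfi β hβ).indicator hUm.compl)]
    congr 1; funext v
    by_cases hv : v ∈ U
    · rw [indicator_of_mem hv, indicator_of_notMem (show v ∉ Uᶜ from fun hc => hc hv), add_zero]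
    · rw [indicator_of_notMem hv, indicator_of_mem (mem_compl hv), zero_add]
  have hβint : ∀ β, β * ∫ v, h v * Real.exp (-(β * G v)) * w v ∂μ = ∫ v, f β v ∂μ := by
    intro β
    rw [← integral_const_mul]
    congr 1; funext v; rw [hf]; ring
  -- (1) exterior
  have hout : Tendsto (fun β : ℝ => Real.sqrt β ^ finrank ℝ E * ∫ v, Uᶜ.indicator (f β) v ∂μ) atTop (𝓝 0) := by
    have h := tendsto_sqrt_pow_mul_pow_mul_of_abs_le (finrank ℝ E) 1 (C := H₀ * ∫ v, w v ∂μ) hs₀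
      (f := fun β => ∫ v, Uᶜ.indicator (fun v => h v * Real.exp (-(β * G v)) * w v) v ∂μ) ?_
    · refine h.congr' ?_
      filter_upwards [eventually_ge_atTop (0 : ℝ)] with β hβ
      rw [pow_one, mul_assoc, ← integral_const_mul]
      congr 2; funext v
      by_cases hv : v ∈ Uᶜ
      · rw [indicator_of_mem hv, indicator_of_mem hv, hf]; ring
      · rw [indicator_of_notMem hv, indicator_of_notMem hv, mul_zero]
    filter_upwards [eventually_ge_atTop (0 : ℝ)] with β hβ
    have h1 := abs_integral_indicator_compl_le μ hGout hw0 hwi hhb hβ (G := G)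
    calc |∫ v, Uᶜ.indicator (fun v => h v * Real.exp (-(β * G v)) * w v) v ∂μ| ≤ H₀ * Real.exp (-(s₀ * β)) * ∫ v, w v ∂μ := h1
      _ = (H₀ * ∫ v, w v ∂μ) * Real.exp (-(s₀ * β)) := by ring
  -- (2) interior
  have hin : Tendsto (fun β : ℝ => Real.sqrt β ^ finrank ℝ E * ∫ v, U.indicator (f β) v ∂μ) atTop
      (𝓝 (w 0 * ∫ z, q z * Real.exp (-Q z) ∂μ)) := by
    have heq : ∀ β, Real.sqrt β ^ finrank ℝ E * ∫ v, U.indicator (f β) v ∂μ =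
        ∫ z, U.indicator (f β) ((Real.sqrt β)⁻¹ • z) ∂μ := fun β => sqrt_pow_mul_integral_eq μ _ β
    simp_rw [heq]
    rw [← integral_const_mul]
    refine tendsto_integral_filter_of_dominated_convergence (fun z => 2 * K * W₀ * Real.exp (-(c / 2 * ‖z‖ ^ 2))) ?_ ?_
      (hgauss.const_mul _) ?_
    · refine Eventually.of_forall fun β => ?_
      exact (((hfm β).indicator hUm).comp (measurable_const_smul _)).aestronglyMeasurable
    · filter_upwards [eventually_gt_atTop (0 : ℝ)] with β hβ
      refine ae_of_all _ fun z => ?_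
      rw [Real.norm_eq_abs]
      by_cases hz : (Real.sqrt β)⁻¹ • z ∈ U
      · rw [indicator_of_mem hz, hf]; dsimp only
        set v := (Real.sqrt β)⁻¹ • z with hv
        set t := β * G v with ht
        have ht0 : 0 ≤ t := mul_nonneg hβ.le (hG0 v)
        have hG1 : c * ‖z‖ ^ 2 ≤ t := by
          have h1 := hGU _ hz
          have h2 := mul_norm_inv_sqrt_smul_sq hβ z
          calc c * ‖z‖ ^ 2 = β * (c * ‖(Real.sqrt β)⁻¹ • z‖ ^ 2) := by rw [← h2]; ring
            _ ≤ t := mul_le_mul_of_nonneg_left h1 hβ.le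
        rw [abs_mul, abs_mul, abs_mul, abs_of_nonneg (Real.exp_pos _).le, abs_of_nonneg (hw0 v), abs_of_nonneg hβ.le]
        have h1 : β * |h v| ≤ K * t := by
          calc β * |h v| ≤ β * (K * G v) := mul_le_mul_of_nonneg_left (hhU v hz) hβ.le
            _ = K * t := by rw [ht]; ring
        have h2 : t * Real.exp (-t) ≤ 2 * Real.exp (-(t / 2)) := Literature.Probability.LatticeModels.mul_exp_neg_le_two_mul_exp_neg_half t
        have h3 : Real.exp (-(t / 2)) ≤ Real.exp (-(c / 2 * ‖z‖ ^ 2)) := by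
          rw [Real.exp_le_exp]; linarith
        calc β * |h v| * Real.exp (-(β * G v)) * w v ≤ K * t * Real.exp (-t) * W₀ := by
              rw [← ht]
              have e1 : β * |h v| * Real.exp (-t) ≤ K * t * Real.exp (-t) :=
                mul_le_mul_of_nonneg_right h1 (Real.exp_pos _).le
              have e0 : 0 ≤ K * t * Real.exp (-t) := mul_nonneg (mul_nonneg hK ht0) (Real.exp_pos _).le
              exact mul_le_mul e1 (hwW v) (hw0 v) e0
          _ = K * (t * Real.exp (-t)) * W₀ := by ring
          _ ≤ K * (2 * Real.exp (-(t / 2))) * W₀ := by gcongr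
          _ ≤ K * (2 * Real.exp (-(c / 2 * ‖z‖ ^ 2))) * W₀ := by gcongr
          _ = 2 * K * W₀ * Real.exp (-(c / 2 * ‖z‖ ^ 2)) := by ring
      · rw [indicator_of_notMem hz, abs_zero]
        exact mul_nonneg (mul_nonneg (mul_nonneg zero_le_two hK) hW₀) (Real.exp_pos _).le
    · refine ae_of_all _ fun z => ?_
      have hzU : ∀ᶠ β : ℝ in atTop, (Real.sqrt β)⁻¹ • z ∈ U := (tendsto_inv_sqrt_smul z) hU0
      have hlim : Tendsto (fun β : ℝ => f β ((Real.sqrt β)⁻¹ • z)) atTop (𝓝 (q z * Real.exp (-Q z) * w 0)) := by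
        have e : ∀ β, f β ((Real.sqrt β)⁻¹ • z) = (β * h ((Real.sqrt β)⁻¹ • z)) *
            Real.exp (-(β * G ((Real.sqrt β)⁻¹ • z))) * w ((Real.sqrt β)⁻¹ • z) := fun β => by rw [hf]
        simp_rw [e]
        exact (((hq z).mul ((Real.continuous_exp.tendsto _).comp (hQ z).neg)).mul
          (hwc.tendsto.comp (tendsto_inv_sqrt_smul z)))
      have hlim' : Tendsto (fun β : ℝ => U.indicator (f β) ((Real.sqrt β)⁻¹ • z)) atTop (𝓝 (q z * Real.exp (-Q z) * w 0)) := by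
        refine hlim.congr' ?_
        filter_upwards [hzU] with β hβ
        rw [indicator_of_mem hβ]
      have e2 : w 0 * (q z * Real.exp (-Q z)) = q z * Real.exp (-Q z) * w 0 := by ring
      rw [e2]; exact hlim'
  have hsum := hin.add hout
  rw [add_zero] at hsum; refine hsum.congr' ?_
  filter_upwards [eventually_ge_atTop (0 : ℝ)] with β hβ; rw [← mul_add, ← hsplit β hβ, hβint]

omit [BorelSpace E] [FiniteDimensional ℝ E] in
/-- The limit Gaussian weight is integrable and has positive total mass: `Q ≥ c‖·‖²` (limit of the interior bound), so
`0 < ∫ e^{−Q} dμ`. [folklore] -/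
theorem integral_exp_neg_limit_pos (hQm : Measurable Q) (hU0 : U ∈ 𝓝 (0 : E)) (hc : 0 < c)
    (hGU : ∀ v ∈ U, c * ‖v‖ ^ 2 ≤ G v)
    (hgauss : Integrable (fun z : E => Real.exp (-(c / 2 * ‖z‖ ^ 2))) μ)
    (hQ : ∀ z, Tendsto (fun β : ℝ => β * G ((Real.sqrt β)⁻¹ • z)) atTop (𝓝 (Q z))) :
    Integrable (fun z => Real.exp (-Q z)) μ ∧ 0 < ∫ z, Real.exp (-Q z) ∂μ := by
  have hQge : ∀ z, c * ‖z‖ ^ 2 ≤ Q z := by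
    intro z
    refine ge_of_tendsto (hQ z) ?_
    filter_upwards [(tendsto_inv_sqrt_smul z) hU0, eventually_gt_atTop (0 : ℝ)] with β hβU hβ
    have h1 := hGU _ hβU
    have h2 := mul_norm_inv_sqrt_smul_sq hβ z
    calc c * ‖z‖ ^ 2 = β * (c * ‖(Real.sqrt β)⁻¹ • z‖ ^ 2) := by rw [← h2]; ring
      _ ≤ β * G ((Real.sqrt β)⁻¹ • z) := mul_le_mul_of_nonneg_left h1 hβ.le
  have hint : Integrable (fun z => Real.exp (-Q z)) μ := by
    refine Integrable.mono' hgauss (Real.measurable_exp.comp hQm.neg).aestronglyMeasurable (ae_of_all _ fun z => ?_)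
    rw [Real.norm_eq_abs, abs_of_nonneg (Real.exp_pos _).le, Real.exp_le_exp]
    nlinarith [hQge z, sq_nonneg ‖z‖]
  refine ⟨hint, ?_⟩
  haveI : NeZero μ := ⟨fun h0 => by
    have h1 : μ U = 0 := by rw [h0]; rfl
    exact (Measure.IsOpenPosMeasure.open_pos (μ := μ) _ isOpen_interior ⟨0, mem_interior_iff_mem_nhds.2 hU0⟩)
      (measure_mono_null interior_subset h1)⟩
  exact integral_exp_pos hint

/-- **THE LAPLACE METHOD IN RATIO FORM.**  Under the hypotheses above (and `w(0) > 0`):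
`β · (∫ h e^{−βG} w dμ) / (∫ e^{−βG} w dμ) → (∫ q e^{−Q} dμ) / (∫ e^{−Q} dμ)`.
[folklore: de Bruijn, Asymptotic Methods in Analysis, Ch. 4; Wong, Asymptotic Approximations of Integrals, Ch. IX §5] -/
theorem tendsto_mul_integral_div_integral (hGm : Measurable G) (hhm : Measurable h) (hwm : Measurable w) (hQm : Measurable Q)
    (hUm : MeasurableSet U) (hU0 : U ∈ 𝓝 (0 : E)) (hc : 0 < c) (hs₀ : 0 < s₀) (hK : 0 ≤ K)
    (hG0 : ∀ v, 0 ≤ G v) (hGU : ∀ v ∈ U, c * ‖v‖ ^ 2 ≤ G v) (hGout : ∀ v ∉ U, s₀ ≤ G v)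
    (hhU : ∀ v ∈ U, |h v| ≤ K * G v) (hhb : ∀ v, |h v| ≤ H₀)
    (hw0 : ∀ v, 0 ≤ w v) (hwW : ∀ v, w v ≤ W₀) (hwi : Integrable w μ) (hwc : ContinuousAt w 0) (hw00 : 0 < w 0)
    (hgauss : Integrable (fun z : E => Real.exp (-(c / 2 * ‖z‖ ^ 2))) μ)
    (hQ : ∀ z, Tendsto (fun β : ℝ => β * G ((Real.sqrt β)⁻¹ • z)) atTop (𝓝 (Q z)))
    (hq : ∀ z, Tendsto (fun β : ℝ => β * h ((Real.sqrt β)⁻¹ • z)) atTop (𝓝 (q z))) :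
    Tendsto (fun β : ℝ => β * (∫ v, h v * Real.exp (-(β * G v)) * w v ∂μ) / (∫ v, Real.exp (-(β * G v)) * w v ∂μ)) atTop
      (𝓝 ((∫ z, q z * Real.exp (-Q z) ∂μ) / (∫ z, Real.exp (-Q z) ∂μ))) := by
  have hN := tendsto_sqrt_pow_mul_mul_integral_mul_exp_neg_mul μ hGm hhm hwm hUm hU0 hs₀ hK hG0 hGU hGout hhU hhb hw0 hwW
    hwi hwc hgauss hQ hq
  have hD := tendsto_sqrt_pow_mul_integral_exp_neg_mul μ hGm hwm hUm hU0 hc hs₀ hG0 hGU hGout hw0 hwW hwi hwc hgauss hQ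
  have hpos := (integral_exp_neg_limit_pos μ hQm hU0 hc hGU hgauss hQ).2
  have hD0 : w 0 * ∫ z, Real.exp (-Q z) ∂μ ≠ 0 := mul_ne_zero hw00.ne' hpos.ne'
  have hdiv := hN.div hD hD0
  rw [mul_div_mul_left _ _ hw00.ne'] at hdiv
  refine hdiv.congr' ?_
  filter_upwards [eventually_gt_atTop (0 : ℝ)] with β hβ
  have hs : Real.sqrt β ^ finrank ℝ E ≠ 0 := pow_ne_zero _ (Real.sqrt_pos.2 hβ).ne'
  rw [Pi.div_apply, mul_div_mul_left _ _ hs]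

end Main

/-! ### §3 Negligible additive perturbations (the far hemispheres) -/

/-- **Ratio limit with negligible perturbations.**  If `(√β)^n·β·N β → A`, `(√β)^n·D β → B ≠ 0`, and the perturbations satisfy
`(√β)^n·β·N' β → 0`, `(√β)^n·D' β → 0`, then `β (N β + N' β)/(D β + D' β) → A/B`. [folklore] -/
theorem tendsto_mul_add_div_add_of_negligible (n : ℕ) {N N' D D' : ℝ → ℝ} {A B : ℝ} (hB : B ≠ 0)
    (hN : Tendsto (fun β : ℝ => Real.sqrt β ^ n * (β * N β)) atTop (𝓝 A))
    (hD : Tendsto (fun β : ℝ => Real.sqrt β ^ n * D β) atTop (𝓝 B))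
    (hN' : Tendsto (fun β : ℝ => Real.sqrt β ^ n * (β * N' β)) atTop (𝓝 0))
    (hD' : Tendsto (fun β : ℝ => Real.sqrt β ^ n * D' β) atTop (𝓝 0)) :
    Tendsto (fun β : ℝ => β * (N β + N' β) / (D β + D' β)) atTop (𝓝 (A / B)) := by
  have h1 : Tendsto (fun β : ℝ => Real.sqrt β ^ n * (β * (N β + N' β))) atTop (𝓝 (A + 0)) := by
    refine (hN.add hN').congr' (Eventually.of_forall fun β => ?_); ring
  have h2 : Tendsto (fun β : ℝ => Real.sqrt β ^ n * (D β + D' β)) atTop (𝓝 (B + 0)) := by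
    refine (hD.add hD').congr' (Eventually.of_forall fun β => ?_); ring
  rw [add_zero] at h1 h2; refine (h1.div h2 hB).congr' ?_
  filter_upwards [eventually_gt_atTop (0 : ℝ)] with β hβ
  have hs : Real.sqrt β ^ n ≠ 0 := pow_ne_zero _ (Real.sqrt_pos.2 hβ).ne'
  rw [Pi.div_apply, mul_div_mul_left _ _ hs]

end Summit.QuantumFields.YangMills.Cruxes.UVSeamRec.ClassicalResponse.ColdWall.Laplace

end
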